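import Mathlib.Analysis.SpecialFunctions.Pow.Real
import Mathlib.Analysis.SpecialFunctions.Log.Basic
import Literature.Computability.AlgebraicComplexity.ArithCircuit
import Literature.Computability.AlgebraicComplexity.CircuitDepth
import Literature.Computability.AlgebraicComplexity.StandardFamilies
import HarnessLib

-- provenance: harness21/H21/H21/Statements/PNP/ConstantDepthIMM.lean @ fb9c2df (interim HEAD d8f2665); M5 mechanical rewrite
/-!
# Superpolynomial lower bounds for constant-depth circuits computing IMM

(Family `pnp`, statement **pnp.S29**; trunk CplxAlg, notion `arithmetic_circuit`.)

Limaye–Srinivasan–Tavenas (FOCS 2021, Thm. 1 = J. ACM 72 (2025), Art. 26, Cor. 4, p. 26:5):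
over a field of characteristic `0` (or `> d`), if `d ≤ (log n)/100` then every algebraic circuit
of product-depth at most `Δ` (unbounded fan-in) computing the iterated matrix multiplication
polynomial `IMM_{n,d}` has size at least `n ^ (d ^ (exp (-O(Δ))))`; in particular constant-depth
circuits for `IMM` have superpolynomial size, the first such bound for general constant-depth
algebraic circuits.

## Design

* We use the H21 circuit model `Literature.Computability.AlgebraicComplexity.ArithCircuit`
  (gate-count `size`, `productDepth`, `Computes`) and the trace form
  `immPoly n d k = tr (X^{(1)} ⋯ X^{(d)})` (`StandardFamilies.lean`) of `IMM_{n,d}` in the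
  `N = d n²` variables `Fin d × Fin n × Fin n`; a single `n` throughout, no `NeZero n`.
* What is printed, and where (J. ACM numbering; held text
  `paper:doi-10-1109-focs52979-2021-00083`). Model (p. 26:2): a circuit is a DAG whose leaves
  are variables or field elements and whose internal nodes are products or linear combinations
  of their children; *size = number of nodes* (leaves included); product-depth = largest number
  of product gates on a root-to-leaf path. `IMM_{n,d}` (p. 26:3) is the `(1,1)` entry of
  `X^{(1)} ⋯ X^{(d)}`, `N = d n²`. Cor. 4 (p. 26:5): `d ≤ (log n)/100`, `char F = 0` or `> d`,
  product-depth `≤ Δ` ⇒ size `≥ n ^ (d ^ (exp (-O(Δ))))` (for `Δ = 1`: `n ^ Ω(√d)`). Proof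
  (pp. 26:12–13): Prop. 9 (pp. 26:9–10; = Lemma 11 + Lemma 12, Lemma 11 being proved as
  Lemma 19 in §7 via the weighted Newton identities of Lemma 20) turns a size-`s`,
  product-depth-`Δ` circuit for a set-multilinear degree-`d` polynomial into a set-multilinear
  circuit of size `d^{O(d)} poly(s)` and product-depth `≤ 2Δ`; Lemma 15 (p. 26:13; Claims 16–17,
  Lemma 8 of §8, the relative-rank measure of Claim 7) bounds set-multilinear circuits of
  product-depth `Δ'` for `IMM_{n,d}`, `n ≥ 2^{10d+1}`, below by `n ^ Ω(d^{1/(2^{Δ'}-1)}/Δ')`;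
  hence `d^{O(d)} poly(s) ≥ n ^ Ω(d^{1/(2^{2Δ}-1)}/(2Δ))`, and `d ≤ (log n)/100` gives the
  bound on `s`.
* Why the Lean shape below follows from the printed Cor. 4 (used as a black box, at
  product-depth `2Δ`). For FIXED `Δ` every step below costs a factor polynomial in `s, n, d`
  (exponent depending on `Δ` only) in size and at most doubles the product-depth, and all of
  this is absorbed by taking `δ` smaller than the printed exponent `exp (-O(2Δ))` and `d₀`
  large (`c · d^a - O_Δ(1) ≥ d^δ` for `δ < a`, `d ≥ d₀`), with `ε ≤ 1/100`:
  (G1) trace versus `(1,1)` entry: substituting `0` for the variables `X^{(1)}_{ij}`, `i ≠ 1`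
  (operands `var ↦ const 0`: same gate list, same product-depth) turns a circuit for the trace
  into one for `tr (X'^{(1)} X^{(2)} ⋯ X^{(d)}) = (X^{(1)} ⋯ X^{(d)})_{11} = IMM_{n,d}` exactly;
  (G2) nodes versus gates: our `size` counts gates only; adding the `≤ N` variable leaves and
  one (merged) constant leaf per gate gives at most `2 s + N` nodes, and `n ^ (d ^ δ)` dominates
  `N = d n²`;
  (G3) repeated operands: `Gate.sum`/`Gate.prod` take *lists* of operands, so `x ^ (2 ^ m)` is a
  single gate here, whereas LST's DAGs have fan-in at most the number of nodes (used in eq. (1),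
  p. 26:16: `t_{u,j} ≤ t`), so "size" must first be normalised, in characteristic `0`: merge
  repeats in sum gates; in a product gate replace every power `u ^ m` with `m > d` by
  `q_m(u) ≡ u ^ m (mod I_{>d})`, `I_{>d}` the ideal spanned by the monomials of degree `> d`,
  where `deg q_m ≤ d` (`u = c + v`, `u ^ m ≡ ∑_{j ≤ d} (m choose j) c^{m-j} v^j`) and
  `q_m(t) = ∑_{i=0}^{d} β_i (t + i) ^ d`, the `(t + i)^d`, `0 ≤ i ≤ d`, spanning `k[t]_{≤ d}`
  when `d! ≠ 0`; then split the remaining repeats (`≤ d` each) by `1 • u` copy gates — in all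
  `O(d²)` new gates per distinct operand of a product gate and one extra product layer per
  product layer (product-depth `≤ 2Δ`). The result computes some `F ≡ IMM_{n,d} (mod I_{>d})`
  of degree polynomial in `s + N + d` for fixed `Δ`, and the homogeneous component
  `F^{(d)} = IMM_{n,d}` is recovered exactly, without changing the product-depth, as a linear
  combination of `deg F + 1` rescaled copies `F(λ • x)` (Vandermonde, characteristic `0`;
  rescaling a variable only changes sum coefficients and constant operands). The earlier remark
  at this place, that the edge count can be made quadratic in the gate count at fixed
  product-depth, was false in this model (`x ^ (2 ^ m)` is one gate) and is withdrawn; (G3) is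
  what replaces it.
* Vacuity: for `n ≤ 1` we have `Real.log n = 0`, so no `d ≥ d₀ ≥ 1` satisfies the hypothesis
  `d ≤ ε log n`; the statement is vacuous there, harmlessly (and `immPoly` is `0` or trivial).
  Likewise `d ≥ d₀` together with `d ≤ ε log n` forces `n` large, matching the asymptotic
  constants of the source.
* Characteristic: LST need characteristic `0` or larger than the degree `d`; we state the
  `CharZero` case only ((G3) also uses `d! ≠ 0`).
* A second, equivalent phrasing `lst_productDepthCircuitSize_lower_bound` uses the `ℕ∞`-valued
  measure `Literature.Computability.AlgebraicComplexity.productDepthCircuitSize`; the equivalence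
  is proved at the end of this file (`lst_productDepthCircuitSize_lower_bound_iff`), so the two
  named facts are one obligation.
* Status: named fact, not discharged. A discharge needs, beyond (G1)–(G3), the whole of LST's
  argument over `ArithCircuit` (set-multilinear and homogeneous sub-circuit classes w.r.t. the
  partition into matrices, expansion of product-depth-`Δ` circuits into formulas of size
  `s^{2Δ}`, the coefficient matrices `M_w(f)` and the relative rank `relrk_w` with its Kronecker
  multiplicativity, word polynomials as restrictions of `IMM` (Lemma 8), the induction of
  Claim 16, set-multilinearisation Lemma 12 and homogenisation Lemmas 19–20), none of which the
  tree has yet.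
* Mathlib has no arithmetic-circuit or `IMM` notion (searched `ArithCircuit`, `productDepth`,
  `IteratedMatrix`); only `Real.log`, `Real.rpow` are used from Mathlib.

## References

* N. Limaye, S. Srinivasan, S. Tavenas, *Superpolynomial lower bounds against low-depth
  algebraic circuits*, J. ACM 72 (2025), no. 4, Art. 26 (journal version of the FOCS 2021
  paper), Thm. 1, Cor. 4, Prop. 9, Lemmas 8, 11, 12, 15, 19, 20, doi:10.1145/3734215 — bib key
  `LimayeSrinivasanTavenas2025`.
* N. Limaye, S. Srinivasan, S. Tavenas, *Superpolynomial lower bounds against low-depth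
  algebraic circuits*, 62nd IEEE FOCS (2021), Thm. 1, doi:10.1109/FOCS52979.2021.00083
  (preliminary version).
-/

namespace Literature.Computability.Complexity

open AlgebraicComplexity

/-- **pnp.S29** (Limaye–Srinivasan–Tavenas, FOCS 2021, Thm. 1 = J. ACM 72 (2025), Art. 26,
Cor. 4, p. 26:5). Constant product-depth `Δ` algebraic circuits (unbounded fan-in) computing
`IMM_{n,d}`, `d ≤ (log n)/100`, need size `n ^ (d ^ (exp (-O(Δ))))` over characteristic `0`:
for every `Δ ≥ 1` there are `δ, ε > 0` and `d₀` such that for all `n` and all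
`d₀ ≤ d ≤ ε log n`, every circuit of product-depth at most `Δ` computing `immPoly n d k` has at
least `n ^ (d ^ δ)` gates. See the module docstring, (G1)–(G3), for how the printed statement
(node count, the `(1,1)` entry, DAGs without repeated operands) yields this shape, the constants
being absorbed into `δ` and `d₀`. [cite: LimayeSrinivasanTavenas2025, Cor. 4] -/
def lst_constantDepth_imm_lower_bound : Prop :=
  ∀ (k : Type*) [Field k] [CharZero k] (Δ : ℕ) (hΔ : 1 ≤ Δ),
    ∃ δ : ℝ, 0 < δ ∧ ∃ ε : ℝ, 0 < ε ∧ ∃ d₀ : ℕ, ∀ n d : ℕ, d₀ ≤ d →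
      (d : ℝ) ≤ ε * Real.log n →
      ∀ C : ArithCircuit k (Fin d × Fin n × Fin n), C.productDepth ≤ Δ →
        C.Computes (immPoly n d k) → (n : ℝ) ^ ((d : ℝ) ^ δ) ≤ (C.size : ℝ)

/-- Limaye–Srinivasan–Tavenas (FOCS 2021, Thm. 1 = J. ACM 72 (2025), Art. 26, Cor. 4),
phrased with the `ℕ∞`-valued minimal size `productDepthCircuitSize Δ f` of a
product-depth-`≤ Δ` circuit computing `f`: for `Δ ≥ 1` there are `δ, ε > 0` and `d₀` such that
for all `n` and `d₀ ≤ d ≤ ε log n`, every natural number `s` bounding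
`productDepthCircuitSize Δ (immPoly n d k)` from above satisfies `n ^ (d ^ δ) ≤ s`. Equivalent
to `lst_constantDepth_imm_lower_bound` (`lst_productDepthCircuitSize_lower_bound_iff` below; no
finiteness of the infimum is needed). [cite: LimayeSrinivasanTavenas2025, Cor. 4] -/
def lst_productDepthCircuitSize_lower_bound : Prop :=
  ∀ (k : Type*) [Field k] [CharZero k] (Δ : ℕ) (hΔ : 1 ≤ Δ),
    ∃ δ : ℝ, 0 < δ ∧ ∃ ε : ℝ, 0 < ε ∧ ∃ d₀ : ℕ, ∀ n d : ℕ, d₀ ≤ d →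
      (d : ℝ) ≤ ε * Real.log n → ∀ s : ℕ,
        productDepthCircuitSize Δ (immPoly n d k) ≤ (s : ℕ∞) →
          (n : ℝ) ^ ((d : ℝ) ^ δ) ≤ (s : ℝ)

/-! ### The two phrasings are equivalent

The module docstring records that `lst_productDepthCircuitSize_lower_bound` (the `ℕ∞`-valued
minimal-size phrasing) and `lst_constantDepth_imm_lower_bound` (the per-circuit phrasing) are two
spellings of the same corollary of LST (J. ACM 72 (2025), Art. 26, Cor. 4 = FOCS 2021, Thm. 1).
The equivalence is elementary and is proved here, so that a discharge of either named fact
discharges the other. No finiteness of the infimum is needed: `→` bounds the infimum by any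
admissible circuit (`productDepthCircuitSize_le`); `←` argues that if `s < n ^ (d ^ δ)` then every
admissible circuit has more than `s` gates, so `s + 1 ≤ productDepthCircuitSize Δ _ ≤ s`. -/

universe u

/-- The per-circuit phrasing of LST, Cor. 4 implies the `ℕ∞`-minimal-size phrasing: if every
product-depth-`≤ Δ` circuit for `IMM_{n,d}` has at least `n ^ (d ^ δ)` gates, then so does every
natural upper bound `s` of `productDepthCircuitSize Δ (immPoly n d k)` (an infimum of gate counts
all `> s` would be `≥ s + 1`). [cite: LimayeSrinivasanTavenas2025, Cor. 4] -/
theorem lst_productDepthCircuitSize_lower_bound_of_constantDepth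
    (h : lst_constantDepth_imm_lower_bound.{u}) :
    lst_productDepthCircuitSize_lower_bound.{u} := by
  intro k _ _ Δ hΔ
  obtain ⟨δ, hδ, ε, hε, d₀, H⟩ := h k Δ hΔ
  refine ⟨δ, hδ, ε, hε, d₀, fun n d hd hdn s hs => ?_⟩
  by_contra hlt
  rw [not_le] at hlt
  have hle : ((s + 1 : ℕ) : ℕ∞) ≤ productDepthCircuitSize Δ (immPoly n d k) := by
    unfold productDepthCircuitSize
    refine le_iInf₂ fun P hP => ?_
    have h1 : (s : ℝ) < (P.size : ℝ) := hlt.trans_le (H n d hd hdn P hP.2 hP.1)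
    exact_mod_cast Nat.succ_le_of_lt (Nat.cast_lt.mp h1)
  have := ENat.coe_le_coe.mp (hle.trans hs)
  omega

/-- The `ℕ∞`-minimal-size phrasing of LST, Cor. 4 implies the per-circuit phrasing: an admissible
circuit `C` bounds `productDepthCircuitSize Δ (immPoly n d k)` by `C.size`
(`productDepthCircuitSize_le`). [cite: LimayeSrinivasanTavenas2025, Cor. 4] -/
theorem lst_constantDepth_imm_lower_bound_of_productDepthCircuitSize
    (h : lst_productDepthCircuitSize_lower_bound.{u}) :
    lst_constantDepth_imm_lower_bound.{u} := by
  intro k _ _ Δ hΔ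
  obtain ⟨δ, hδ, ε, hε, d₀, H⟩ := h k Δ hΔ
  exact ⟨δ, hδ, ε, hε, d₀, fun n d hd hdn C hCΔ hC =>
    H n d hd hdn C.size (productDepthCircuitSize_le hC hCΔ)⟩

/-- The two vendored phrasings of Limaye–Srinivasan–Tavenas (FOCS 2021, Thm. 1; J. ACM 72
(2025), Art. 26, Cor. 4) are equivalent. [cite: LimayeSrinivasanTavenas2025, Cor. 4] -/
theorem lst_productDepthCircuitSize_lower_bound_iff :
    lst_productDepthCircuitSize_lower_bound.{u} ↔ lst_constantDepth_imm_lower_bound.{u} :=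
  ⟨lst_constantDepth_imm_lower_bound_of_productDepthCircuitSize,
    lst_productDepthCircuitSize_lower_bound_of_constantDepth⟩

end Literature.Computability.Complexity
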